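import Summits.ValiantsHypothesis.ValiantsHypothesis.Theorems.BinomialElusivePeelingLemmaWindowDefs

/-!
# Window calculus for wide-FIFO vertex vectors (all-X designs against `BinomialElusive.PeelingLemma`)

Helper file for the crux stmt-ValiantsHypothesis-7391 (negative lane; blueprint
Cruxes/PeelingLemma/DETERMINISTIC-ALLX.md §1a/§3).  Along one arm of a theta gadget the vertex
vectors of a wide-FIFO all-X design have the closed form

  `win f q t = Σ_{i=0}^{2q} (-1)^i · e_{f(t-i)}`     (letters `f(t), f(t-1), …, f(t-2q)`, alternating signs)

for an INJECTIVE birth sequence `f : ℤ → Λ` (position `t` on the arm is born letter `f t`, which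
lives for `2q+1` steps); `win` is declared in `BinomialElusivePeelingLemmaWindowDefs.lean`.  This file
proves the atoms of the local analysis:

* `win_add_win_succ` — the PAIR-LABEL identity `win t + win (t+1) = e_{f(t+1)} + e_{f(t-2q)}`
  (telescoping; no injectivity needed): consecutive vertices give an X-output;
* `win_apply_born` — the coefficient of the letter `f τ` in `win t` is `(-1)^{t-τ}` if
  `τ ≤ t ≤ τ+2q` and `0` otherwise (injectivity);
* `charge_sum_apply_born` — hence the coefficient of `f τ` in a charge combination
  `Σ_{t∈S} c_t · win t` is the ALTERNATING INTERVAL SUM of `c` over `[τ, τ+2q]`;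
* `charge_sum_apply_top` / `charge_sum_apply_bottom` — the letter born at the LAST charged
  position `t₁`, and the letter `f(t₀-2q)` dying right after the FIRST charged position `t₀`, carry
  the bare charges `c t₁`, `c t₀`: two "private" support letters (`born_top_ne_bottom`), and in
  particular a nonzero charge configuration never has `σ = 0` (`charge_sum_ne_zero`, Lemma E1 of
  ALLX-PROOF-SKETCH §5 in its simplest form: no window-length hypothesis is needed);
* `sum_win_eq_one` — every window vector has coordinate sum `1` (the positivity input of
  `peelingLemma_false_of_allXVectorDesigns`, p557246).

Pure combinatorics over `Mathlib` (+ the Defs file); no Theses import.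
-/

namespace Summit.ValiantsHypothesis.ValiantsHypothesis.Theorems.PeelingLemmaWindow

-- summit = sub-problem name (single-conjunct summit, D-0017 layout), so the namespace repeats it
set_option linter.dupNamespace false

open scoped BigOperators
open Finset

variable {Λ : Type*} [DecidableEq Λ]

/-- The indicator `[μ = ν]` evaluates to `1` on the diagonal. -/
theorem ite_eq_self (μ : Λ) : (if μ = μ then (1 : ℤ) else 0) = 1 := if_pos rfl

/-- The indicator `[μ = ν]` vanishes off the diagonal. -/
theorem ite_eq_of_ne {μ ν : Λ} (h : μ ≠ ν) : (if μ = ν then (1 : ℤ) else 0) = 0 := if_neg h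

/-- **Pair-label identity.**  `win t + win (t+1) = e_{f(t+1)} + e_{f(t-2q)}`: the letter born at
`t+1` and the letter of age `2q` at `t` (which dies at `t+1`); all other letters cancel because
their signs alternate.  This is what makes every arm edge an X-output. -/
theorem win_add_win_succ (f : ℤ → Λ) (q : ℕ) (t : ℤ) (ν : Λ) :
    win f q t ν + win f q (t + 1) ν =
      (if f (t + 1) = ν then 1 else 0) + (if f (t - 2 * q) = ν then 1 else 0) := by
  unfold win
  rw [Finset.sum_range_succ, Finset.sum_range_succ']
  have hre : ∀ i ∈ Finset.range (2 * q),
      (-1 : ℤ) ^ (i + 1) * (if f (t + 1 - ((i + 1 : ℕ) : ℤ)) = ν then (1 : ℤ) else 0) =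
        -((-1 : ℤ) ^ i * (if f (t - (i : ℤ)) = ν then (1 : ℤ) else 0)) := by
    intro i _
    have : t + 1 - ((i + 1 : ℕ) : ℤ) = t - (i : ℤ) := by push_cast; ring
    rw [this, pow_succ]
    ring
  rw [Finset.sum_congr rfl hre, Finset.sum_neg_distrib]
  have h2q : ((2 * q : ℕ) : ℤ) = 2 * (q : ℤ) := by push_cast; ring
  simp only [pow_zero, one_mul, Nat.cast_zero, sub_zero, h2q, Even.neg_pow (even_two_mul q),
    one_pow]
  ring

/-- Coefficient of a BORN letter: for injective `f`, the letter `f τ` occurs in `win t` with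
coefficient `(-1)^{t-τ}` when `τ ≤ t ≤ τ + 2q` (it is alive, with age `t - τ`), and `0` otherwise. -/
theorem win_apply_born {f : ℤ → Λ} (hf : Function.Injective f) (q : ℕ) (t τ : ℤ) :
    win f q t (f τ) = if τ ≤ t ∧ t ≤ τ + 2 * q then (-1) ^ (t - τ).toNat else 0 := by
  unfold win
  split_ifs with h
  · -- exactly the term `i = t - τ` survives
    have hn : (t - τ).toNat < 2 * q + 1 := by
      have : t - τ ≤ 2 * q := by linarith [h.2]
      omega
    rw [Finset.sum_eq_single_of_mem ((t - τ).toNat) (Finset.mem_range.mpr hn)]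
    · have : ((t - τ).toNat : ℤ) = t - τ := Int.toNat_of_nonneg (by linarith [h.1])
      rw [this, sub_sub_cancel, ite_eq_self, mul_one]
    · intro i _ hi
      rw [ite_eq_of_ne, mul_zero]
      intro hfi
      have hti : t - (i : ℤ) = τ := hf hfi
      apply hi
      omega
  · refine Finset.sum_eq_zero fun i hi => ?_
    rw [ite_eq_of_ne, mul_zero]
    intro hfi
    have hti : t - (i : ℤ) = τ := hf hfi
    have hi' : i < 2 * q + 1 := Finset.mem_range.mp hi
    apply h
    constructor
    · omega
    · have : (i : ℤ) ≤ 2 * q := by exact_mod_cast Nat.lt_succ_iff.mp hi'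
      omega

/-- Coefficient of the born letter `f τ` in a charge combination `Σ_{t ∈ S} c t · win t`: the
ALTERNATING INTERVAL SUM of the charges over the life `[τ, τ + 2q]` of that letter. -/
theorem charge_sum_apply_born {f : ℤ → Λ} (hf : Function.Injective f) (q : ℕ) (S : Finset ℤ)
    (c : ℤ → ℤ) (τ : ℤ) :
    ∑ t ∈ S, c t * win f q t (f τ) =
      ∑ t ∈ S.filter (fun t => τ ≤ t ∧ t ≤ τ + 2 * q), (-1) ^ (t - τ).toNat * c t := by
  rw [Finset.sum_filter]
  refine Finset.sum_congr rfl fun t _ => ?_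
  rw [win_apply_born hf]
  split_ifs <;> ring

/-- **Top letter.**  If `t₁ ∈ S` and every LATER position in `S` carries charge `0`, then the letter
born at `t₁` carries exactly the charge `c t₁` (it is seen by no other charged position). -/
theorem charge_sum_apply_top {f : ℤ → Λ} (hf : Function.Injective f) (q : ℕ) (S : Finset ℤ)
    (c : ℤ → ℤ) {t₁ : ℤ} (ht₁ : t₁ ∈ S) (htop : ∀ t ∈ S, t₁ < t → c t = 0) :
    ∑ t ∈ S, c t * win f q t (f t₁) = c t₁ := by
  rw [charge_sum_apply_born hf]
  rw [Finset.sum_eq_single_of_mem t₁]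
  · simp
  · exact Finset.mem_filter.mpr ⟨ht₁, le_refl _, by linarith⟩
  · intro t ht hne
    obtain ⟨htS, hτ, _⟩ := Finset.mem_filter.mp ht
    rw [htop t htS (lt_of_le_of_ne hτ (Ne.symm hne)), mul_zero]

/-- **Bottom letter.**  If `t₀ ∈ S` and every EARLIER position in `S` carries charge `0`, then the
letter `f (t₀ - 2q)` (of age `2q` at `t₀`, dead from `t₀ + 1` on) carries exactly `c t₀`. -/
theorem charge_sum_apply_bottom {f : ℤ → Λ} (hf : Function.Injective f) (q : ℕ) (S : Finset ℤ)
    (c : ℤ → ℤ) {t₀ : ℤ} (ht₀ : t₀ ∈ S) (hbot : ∀ t ∈ S, t < t₀ → c t = 0) :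
    ∑ t ∈ S, c t * win f q t (f (t₀ - 2 * q)) = c t₀ := by
  rw [charge_sum_apply_born hf]
  rw [Finset.sum_eq_single_of_mem t₀]
  · have : (t₀ - (t₀ - 2 * (q : ℤ))).toNat = 2 * q := by
      rw [sub_sub_cancel]; exact_mod_cast Int.toNat_natCast (2 * q)
    rw [this, Even.neg_pow (even_two_mul q), one_pow, one_mul]
  · exact Finset.mem_filter.mpr ⟨ht₀, by linarith, by linarith⟩
  · intro t ht hne
    obtain ⟨htS, _, hτ⟩ := Finset.mem_filter.mp ht
    have htle : t ≤ t₀ := by linarith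
    rw [hbot t htS (lt_of_le_of_ne htle hne), mul_zero]

omit [DecidableEq Λ] in
/-- The two private letters are distinct: `f t₁ ≠ f (t₀ - 2q)` as soon as `t₀ - 2q ≠ t₁`
(in particular whenever `t₀ ≤ t₁` and `q ≥ 1`, or `t₀ < t₁`). -/
theorem born_top_ne_bottom {f : ℤ → Λ} (hf : Function.Injective f) (q : ℕ) {t₀ t₁ : ℤ}
    (h : t₀ - 2 * q ≠ t₁) : f t₁ ≠ f (t₀ - 2 * q) :=
  fun hft => h (hf hft).symm

/-- **Lemma E1 (no window hypothesis).**  A charge combination `Σ_{t∈S} c t · win t` along one arm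
with injective birth sequence vanishes only if every charge vanishes: the letter born at the last
position with nonzero charge sees that charge alone. -/
theorem charge_sum_ne_zero {f : ℤ → Λ} (hf : Function.Injective f) (q : ℕ) (S : Finset ℤ)
    (c : ℤ → ℤ) (hc : ∃ t ∈ S, c t ≠ 0) :
    (fun ν => ∑ t ∈ S, c t * win f q t ν) ≠ 0 := by
  classical
  intro hzero
  set S' := S.filter (fun t => c t ≠ 0) with hS'
  have hne : S'.Nonempty := by
    obtain ⟨t, ht, hct⟩ := hc
    exact ⟨t, Finset.mem_filter.mpr ⟨ht, hct⟩⟩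
  set t₁ := S'.max' hne with ht₁
  have ht₁mem : t₁ ∈ S' := Finset.max'_mem S' hne
  obtain ⟨ht₁S, hct₁⟩ := Finset.mem_filter.mp ht₁mem
  have htop : ∀ t ∈ S, t₁ < t → c t = 0 := by
    intro t ht hlt
    by_contra hct
    have : t ≤ t₁ := Finset.le_max' S' t (Finset.mem_filter.mpr ⟨ht, hct⟩)
    linarith
  have h := congrFun hzero (f t₁)
  simp only [Pi.zero_apply] at h
  rw [charge_sum_apply_top hf q S c ht₁S htop] at h
  exact hct₁ h

/-- Coordinate sum of a window vector over a finite alphabet: `Σ_ν win t ν = 1` (there are `q+1`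
plus letters and `q` minus letters).  This is the positivity input of p557246. -/
theorem sum_win_eq_one [Fintype Λ] (f : ℤ → Λ) (q : ℕ) (t : ℤ) : ∑ ν, win f q t ν = 1 := by
  unfold win
  rw [Finset.sum_comm]
  have hind : ∀ i : ℕ,
      ∑ ν, (-1 : ℤ) ^ i * (if f (t - i) = ν then (1 : ℤ) else 0) = (-1) ^ i := by
    intro i
    rw [← Finset.mul_sum]
    have : ∑ ν, (if f (t - i) = ν then (1 : ℤ) else 0) = 1 := by
      rw [Finset.sum_eq_single_of_mem (f (t - i)) (Finset.mem_univ _)]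
      · exact ite_eq_self _
      · intro ν _ hν; exact ite_eq_of_ne (Ne.symm hν)
    rw [this, mul_one]
  simp only [hind]
  rw [neg_one_geom_sum]
  simp

end Summit.ValiantsHypothesis.ValiantsHypothesis.Theorems.PeelingLemmaWindow
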